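import Mathlib
import Literature.Geometry.DiscreteGeometry.MultiregularPointSystems
import Literature.MathematicalPhysics.StatisticalMechanics.Crystallization
import Literature.Probability.Process.RootedHardCoreConfig

/-!
# Finitely many symmetry orbits and a finite point group make a Delone set periodic

Stub `stub_periodicOfFinitePointGroup` of line `Sketch` (crux `IsometryAtoms.AtomicLawChargesCrystal`,
stmt-AtomisticToContinuum-15778): the last, soft step of the Bieberbach-type argument.

For a Delone set `D ⊆ ℝ³` write `Sym D = {g : ℝ³ ≃ᵃⁱ ℝ³ | g '' D = D}`.  Assume `Sym D` has finitely many
orbits on `D` (`HasFinitelyManySymmetryOrbits`) and the point group `{g.linear | g ∈ Sym D}` is finite.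

* `lfp_apply_symm_eq`, `lfp_translation_mem` — two symmetries with the same linear part differ by a
  translation vector `v` of `D` (`∀ x, x ∈ D ↔ x + v ∈ D`);
* `lfp_cocompact` — finitely many orbits make every orbit `Sym(D)·q` relatively dense;
* `lfp_span_eq_top` — a set of vectors `T` such that finitely many translates `b + T` are jointly
  relatively dense spans `ℝ³` (a unit normal of `span T` would give a far point);
* `lfp_exists_lattice` — hence the translation vectors form a discrete (packing radius) `ℤ`-submodule
  spanning `ℝ³`, leaving `D` invariant;
* `lfp_periodic_of_lattice` — a non-empty uniformly discrete set invariant under a full lattice `L` is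
  `Q.points` for the `PeriodicConfiguration` with lattice `L` and motif `D ∩ (fundamental domain)`
  (`ZSpan.fract` / `ZSpan.floor`);
* `stub_periodicOfFinitePointGroup` — the registered statement.

References: Lagarias, *Point lattices* (GrahamGrotschelLovasz1996, ch. 19) Thm 5.2;
DolbilinLagariasSenechal1998 Thm 1.1; Baake–Grimm, *Aperiodic Order* vol. 1 (2013), ch. 3.
-/

noncomputable section

namespace Summit.AtomisticToContinuum.Crystallization.Theorems.IsometryAtomsAtomicLawChargesCrystal

open Metric

/-! ## Symmetries: membership transport and translations -/

/-- If `g '' X = X` then `g w ∈ X ↔ w ∈ X`. [folklore] -/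
theorem lfp_mem_iff_of_image_eq {g : EuclideanSpace ℝ (Fin 3) ≃ᵃⁱ[ℝ] EuclideanSpace ℝ (Fin 3)}
    {X : Set (EuclideanSpace ℝ (Fin 3))} (hg : g '' X = X) (w : EuclideanSpace ℝ (Fin 3)) :
    g w ∈ X ↔ w ∈ X := by
  have h : g w ∈ g '' X ↔ w ∈ X := g.injective.mem_set_image
  rwa [hg] at h

/-- The inverse of a symmetry of `X` is a symmetry of `X`. [folklore] -/
theorem lfp_symm_image_eq {g : EuclideanSpace ℝ (Fin 3) ≃ᵃⁱ[ℝ] EuclideanSpace ℝ (Fin 3)}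
    {X : Set (EuclideanSpace ℝ (Fin 3))} (hg : g '' X = X) : g.symm '' X = X := by
  have h : g.symm '' (g '' X) = X := by
    rw [Set.image_image]
    simp
  rwa [hg] at h

/-- Two affine isometries with the same linear part differ by a translation:
`g (h⁻¹ y) = y + (g q - h q)`. [folklore] -/
theorem lfp_apply_symm_eq {g h : EuclideanSpace ℝ (Fin 3) ≃ᵃⁱ[ℝ] EuclideanSpace ℝ (Fin 3)}
    (hgh : g.linearIsometryEquiv = h.linearIsometryEquiv) (q y : EuclideanSpace ℝ (Fin 3)) :
    g (h.symm y) = y + (g q - h q) := by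
  have h1 := g.map_vsub (h.symm y) q
  have h2 := h.map_vsub (h.symm y) q
  rw [hgh, h2, h.apply_symm_apply, vsub_eq_sub, vsub_eq_sub] at h1
  calc g (h.symm y) = (g (h.symm y) - g q) + g q := (sub_add_cancel _ _).symm
    _ = (y - h q) + g q := by rw [← h1]
    _ = y + (g q - h q) := by abel

/-- If two symmetries `g, h` of `X` have the same linear part, then `v = g q - h q` is a translation
vector of `X`: `x ∈ X ↔ x + v ∈ X`. [folklore] -/
theorem lfp_translation_mem {X : Set (EuclideanSpace ℝ (Fin 3))}
    {g h : EuclideanSpace ℝ (Fin 3) ≃ᵃⁱ[ℝ] EuclideanSpace ℝ (Fin 3)} (hg : g '' X = X) (hh : h '' X = X)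
    (hgh : g.linearIsometryEquiv = h.linearIsometryEquiv) (q x : EuclideanSpace ℝ (Fin 3)) :
    x ∈ X ↔ x + (g q - h q) ∈ X := by
  rw [← lfp_apply_symm_eq hgh q x, lfp_mem_iff_of_image_eq hg,
    lfp_mem_iff_of_image_eq (lfp_symm_image_eq hh)]

/-! ## Cocompactness of an orbit -/

/-- **Finitely many orbits ⇒ every orbit is relatively dense.**  If `Sym D` has finitely many orbits on
the Delone set `D` (representatives `S`), then for every `q` and every `z` some symmetry `g` of `D` has
`dist (g q) z ≤ ∑_{s ∈ S} dist q s + R_c`: pick `x ∈ D` within the covering radius of `z` and `g₀` with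
`g₀ x ∈ S`; then `g = g₀⁻¹` works since `dist (g₀⁻¹ q) x = dist q (g₀ x)`. [folklore] -/
theorem lfp_cocompact (D : Delone.DeloneSet (EuclideanSpace ℝ (Fin 3)))
    (hfin : Literature.Geometry.DiscreteGeometry.HasFinitelyManySymmetryOrbits
      (D : Set (EuclideanSpace ℝ (Fin 3)))) (q : EuclideanSpace ℝ (Fin 3)) :
    ∃ R₁ : ℝ, ∀ z : EuclideanSpace ℝ (Fin 3),
      ∃ g : EuclideanSpace ℝ (Fin 3) ≃ᵃⁱ[ℝ] EuclideanSpace ℝ (Fin 3),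
        g '' (D : Set (EuclideanSpace ℝ (Fin 3))) = (D : Set (EuclideanSpace ℝ (Fin 3))) ∧
          dist (g q) z ≤ R₁ := by
  obtain ⟨S, hS⟩ := hfin
  refine ⟨(∑ s ∈ S, dist q s) + D.coveringRadius, fun z => ?_⟩
  obtain ⟨x, hx, hzx⟩ := D.exists_dist_le_coveringRadius z
  obtain ⟨g, hg, hgx⟩ := hS x hx
  refine ⟨g.symm, lfp_symm_image_eq hg, ?_⟩
  calc dist (g.symm q) z ≤ dist (g.symm q) x + dist x z := dist_triangle _ _ _
    _ = dist q (g x) + dist z x := by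
        rw [← g.dist_map (g.symm q) x, g.apply_symm_apply, dist_comm x z]
    _ ≤ (∑ s ∈ S, dist q s) + D.coveringRadius :=
        add_le_add (Finset.single_le_sum (f := fun s => dist q s) (fun _ _ => dist_nonneg) hgx) hzx

/-! ## Full rank of the translation vectors -/

/-- **A cocompact union of finitely many translates of `T` forces `span T = ℝ³`.**  If for some finite
set `B` of base points every `z ∈ ℝ³` is within `R₁` of a point `v + b`, `v ∈ T`, `b ∈ B`, then
`Submodule.span ℝ T = ⊤`: otherwise a unit normal `n` of `span T` gives the point
`z = (M + R₁ + 1) • n`, `M = ∑_{b ∈ B} |⟪b, n⟫|`, with `⟪z - (v + b), n⟫ ≥ R₁ + 1 > ‖z - (v + b)‖`.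
[folklore] -/
theorem lfp_span_eq_top {T B : Set (EuclideanSpace ℝ (Fin 3))} (hB : B.Finite) {R₁ : ℝ}
    (H : ∀ z : EuclideanSpace ℝ (Fin 3), ∃ b ∈ B, ∃ v ∈ T, dist (v + b) z ≤ R₁) :
    Submodule.span ℝ T = ⊤ := by
  by_contra hW
  have hbot : (Submodule.span ℝ T)ᗮ ≠ ⊥ := by
    rwa [Ne, Submodule.orthogonal_eq_bot_iff]
  obtain ⟨n₀, hn₀W, hn₀⟩ := Submodule.exists_mem_ne_zero_of_ne_bot hbot
  set n : EuclideanSpace ℝ (Fin 3) := (‖n₀‖⁻¹ : ℝ) • n₀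
  have hn1 : ‖n‖ = 1 := norm_smul_inv_norm hn₀
  have hnW : n ∈ (Submodule.span ℝ T)ᗮ := Submodule.smul_mem _ _ hn₀W
  have horth : ∀ v ∈ T, inner ℝ v n = 0 := fun v hv =>
    Submodule.inner_right_of_mem_orthogonal (Submodule.subset_span hv) hnW
  set M : ℝ := ∑ b ∈ hB.toFinset, |inner ℝ b n|
  have hMb : ∀ b ∈ B, inner ℝ b n ≤ M := fun b hb =>
    (le_abs_self _).trans
      (Finset.single_le_sum (f := fun b => |inner ℝ b n|) (fun _ _ => abs_nonneg _)
        (hB.mem_toFinset.2 hb))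
  obtain ⟨b, hb, v, hv, hdist⟩ := H ((M + R₁ + 1) • n)
  have h1 : inner ℝ ((M + R₁ + 1) • n - (v + b)) n = (M + R₁ + 1) - inner ℝ b n := by
    rw [inner_sub_left, inner_add_left, real_inner_smul_left, real_inner_self_eq_norm_sq, hn1,
      horth v hv]
    ring
  have h2 : inner ℝ ((M + R₁ + 1) • n - (v + b)) n ≤ R₁ := by
    refine (real_inner_le_norm _ _).trans ?_
    rw [hn1, mul_one, ← dist_eq_norm, dist_comm]
    exact hdist
  linarith [hMb b hb]

/-! ## The translation lattice -/

/-- **Finitely many orbits + finite point group ⇒ a full translation lattice.**  For a Delone set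
`D ⊆ ℝ³` with finitely many `Sym(D)`-orbits and finitely many linear parts of symmetries, the translation
vectors `T = {v | ∀ x, x ∈ D ↔ x + v ∈ D}` form a `ℤ`-submodule `L` of `ℝ³` which is discrete (a non-zero
translation vector is longer than the packing radius), spans `ℝ³` (with representatives `g_A ∈ Sym D` of
the linear parts `A`, `g q₀ - g_{lin g} q₀ ∈ T`, so the cocompact orbit `Sym(D)·q₀` lies in finitely
many translates of `T`, and `lfp_span_eq_top` applies) and leaves `D` invariant.
[cite: GrahamGrotschelLovasz1996, ch. 19 (Lagarias, Point lattices) Thm 5.2] -/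
theorem lfp_exists_lattice (D : Delone.DeloneSet (EuclideanSpace ℝ (Fin 3)))
    (hfin : Literature.Geometry.DiscreteGeometry.HasFinitelyManySymmetryOrbits
      (D : Set (EuclideanSpace ℝ (Fin 3))))
    (hP : {A : EuclideanSpace ℝ (Fin 3) ≃ₗᵢ[ℝ] EuclideanSpace ℝ (Fin 3) |
      ∃ g : EuclideanSpace ℝ (Fin 3) ≃ᵃⁱ[ℝ] EuclideanSpace ℝ (Fin 3),
        g '' (D : Set (EuclideanSpace ℝ (Fin 3))) = (D : Set (EuclideanSpace ℝ (Fin 3))) ∧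
          g.linearIsometryEquiv = A}.Finite) :
    ∃ L : Submodule ℤ (EuclideanSpace ℝ (Fin 3)), DiscreteTopology L ∧
      Submodule.span ℝ (L : Set (EuclideanSpace ℝ (Fin 3))) = ⊤ ∧
        ∀ v ∈ L, ∀ x ∈ (D : Set (EuclideanSpace ℝ (Fin 3))),
          x + v ∈ (D : Set (EuclideanSpace ℝ (Fin 3))) := by
  obtain ⟨q₀, hq₀⟩ := D.nonempty
  -- the additive group of translation vectors of `D`
  let Tg : AddSubgroup (EuclideanSpace ℝ (Fin 3)) :=
    { carrier := {v | ∀ x, x ∈ (D : Set (EuclideanSpace ℝ (Fin 3))) ↔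
        x + v ∈ (D : Set (EuclideanSpace ℝ (Fin 3)))}
      add_mem' := fun {v w} hv hw x => by rw [hv x, hw (x + v), add_assoc]
      zero_mem' := fun x => by rw [add_zero]
      neg_mem' := fun {v} hv x => by rw [hv (x + -v), neg_add_cancel_right] }
  have hmem : ∀ v : EuclideanSpace ℝ (Fin 3), v ∈ Tg ↔
      ∀ x, x ∈ (D : Set (EuclideanSpace ℝ (Fin 3))) ↔ x + v ∈ (D : Set (EuclideanSpace ℝ (Fin 3))) :=
    fun v => Iff.rfl
  refine ⟨Tg.toIntSubmodule, ?_, ?_, fun v hv x hx => (((hmem v).1 hv) x).1 hx⟩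
  · -- discreteness: two distinct translation vectors are more than the packing radius apart
    refine DiscreteTopology.of_forall_le_dist (NNReal.coe_pos.2 D.packingRadius_pos) ?_
    intro x y hxy
    have hv : (x : EuclideanSpace ℝ (Fin 3)) - y ∈ Tg := Tg.sub_mem x.2 y.2
    have hne : q₀ ≠ q₀ + ((x : EuclideanSpace ℝ (Fin 3)) - y) := by
      intro h
      have h' : (x : EuclideanSpace ℝ (Fin 3)) - y = 0 := by
        simpa using h.symm
      exact hxy (Subtype.ext (sub_eq_zero.1 h'))
    have hlt := D.packingRadius_lt_dist_of_mem_ne hq₀ (((hmem _).1 hv q₀).1 hq₀) hne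
    rw [dist_self_add_right] at hlt
    rw [Subtype.dist_eq, dist_eq_norm]
    exact hlt.le
  · -- full rank, by cocompactness of the orbit of `q₀`
    have hrep : ∀ A ∈ {A : EuclideanSpace ℝ (Fin 3) ≃ₗᵢ[ℝ] EuclideanSpace ℝ (Fin 3) |
        ∃ g : EuclideanSpace ℝ (Fin 3) ≃ᵃⁱ[ℝ] EuclideanSpace ℝ (Fin 3),
          g '' (D : Set (EuclideanSpace ℝ (Fin 3))) = (D : Set (EuclideanSpace ℝ (Fin 3))) ∧
            g.linearIsometryEquiv = A},
        ∃ g : EuclideanSpace ℝ (Fin 3) ≃ᵃⁱ[ℝ] EuclideanSpace ℝ (Fin 3),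
          g '' (D : Set (EuclideanSpace ℝ (Fin 3))) = (D : Set (EuclideanSpace ℝ (Fin 3))) ∧
            g.linearIsometryEquiv = A := fun A hA => hA
    choose! rep hrepD hrepA using hrep
    obtain ⟨R₁, hR₁⟩ := lfp_cocompact D hfin q₀
    rw [AddSubgroup.coe_toIntSubmodule]
    refine lfp_span_eq_top (hP.image fun A => rep A q₀) (R₁ := R₁) fun z => ?_
    obtain ⟨g, hg, hgz⟩ := hR₁ z
    have hA : g.linearIsometryEquiv ∈ {A : EuclideanSpace ℝ (Fin 3) ≃ₗᵢ[ℝ] EuclideanSpace ℝ (Fin 3) |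
        ∃ g : EuclideanSpace ℝ (Fin 3) ≃ᵃⁱ[ℝ] EuclideanSpace ℝ (Fin 3),
          g '' (D : Set (EuclideanSpace ℝ (Fin 3))) = (D : Set (EuclideanSpace ℝ (Fin 3))) ∧
            g.linearIsometryEquiv = A} := ⟨g, hg, rfl⟩
    refine ⟨rep g.linearIsometryEquiv q₀, Set.mem_image_of_mem _ hA,
      g q₀ - rep g.linearIsometryEquiv q₀, ?_, ?_⟩
    · exact (hmem _).2
        (lfp_translation_mem hg (hrepD _ hA) (hrepA _ hA).symm q₀)
    · rwa [sub_add_cancel]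

/-! ## Packaging into a periodic configuration -/

/-- **A lattice-invariant Delone set is a periodic configuration.**  If the Delone set `D ⊆ ℝ³` is
invariant under the full lattice `L` (`x ∈ D, v ∈ L ⇒ x + v ∈ D`), then `D = Q.points` for the periodic
configuration `Q` with lattice `L` and motif `D ∩ F`, `F` the fundamental domain of a `ℤ`-basis of `L`:
the motif is finite (uniformly discrete ∩ bounded), non-empty and exhausting (`x = fract x + floor x`
with `fract x ∈ D ∩ F`, `floor x ∈ L`), and its points are pairwise inequivalent modulo `L`
(`ZSpan.fract_eq_fract`). [cite: BlancLewin2015, §2.1 (17)–(18)] -/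
theorem lfp_periodic_of_lattice (D : Delone.DeloneSet (EuclideanSpace ℝ (Fin 3)))
    (L : Submodule ℤ (EuclideanSpace ℝ (Fin 3))) [DiscreteTopology L] [IsZLattice ℝ L]
    (hLD : ∀ v ∈ L, ∀ x ∈ (D : Set (EuclideanSpace ℝ (Fin 3))),
      x + v ∈ (D : Set (EuclideanSpace ℝ (Fin 3)))) :
    ∃ Q : Literature.MathematicalPhysics.StatisticalMechanics.PeriodicConfiguration 3,
      Q.lattice = L ∧ Q.points = (D : Set (EuclideanSpace ℝ (Fin 3))) := by
  classical
  set b := (Module.Free.chooseBasis ℤ L).ofZLatticeBasis ℝ L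
  have hbL : Submodule.span ℤ (Set.range b) = L :=
    (Module.Free.chooseBasis ℤ L).ofZLatticeBasis_span ℝ L
  have hfloor : ∀ x : EuclideanSpace ℝ (Fin 3), (ZSpan.floor b x : EuclideanSpace ℝ (Fin 3)) ∈ L :=
    fun x => hbL.le (ZSpan.floor b x).2
  -- the fundamental domain and the motif
  obtain ⟨r, hFr⟩ := (ZSpan.fundamentalDomain_isBounded b).subset_closedBall 0
  have hsep : ∀ x ∈ (D : Set (EuclideanSpace ℝ (Fin 3))), ∀ y ∈ (D : Set (EuclideanSpace ℝ (Fin 3))),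
      x ≠ y → (D.packingRadius : ℝ) ≤ dist x y :=
    fun x hx y hy hxy => (D.packingRadius_lt_dist_of_mem_ne hx hy hxy).le
  have hfinite : (ZSpan.fundamentalDomain b ∩ (D : Set (EuclideanSpace ℝ (Fin 3)))).Finite :=
    (Literature.Probability.Process.LocalConfig.finite_inter_of_separated
      (NNReal.coe_pos.2 D.packingRadius_pos) hsep (isCompact_closedBall 0 r)).subset
      (Set.inter_subset_inter_left _ hFr)
  have hsub : ∀ x ∈ (D : Set (EuclideanSpace ℝ (Fin 3))), ∀ v ∈ L,
      x - v ∈ (D : Set (EuclideanSpace ℝ (Fin 3))) := fun x hx v hv => by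
    simpa [sub_eq_add_neg] using hLD (-v) (L.neg_mem hv) x hx
  have hfractD : ∀ x ∈ (D : Set (EuclideanSpace ℝ (Fin 3))),
      ZSpan.fract b x ∈ (D : Set (EuclideanSpace ℝ (Fin 3))) := fun x hx => by
    rw [ZSpan.fract_apply]
    exact hsub x hx _ (hfloor x)
  have hmotif : ∀ x ∈ (D : Set (EuclideanSpace ℝ (Fin 3))), ZSpan.fract b x ∈ hfinite.toFinset :=
    fun x hx => hfinite.mem_toFinset.2 ⟨ZSpan.fract_mem_fundamentalDomain b x, hfractD x hx⟩
  obtain ⟨q₀, hq₀⟩ := D.nonempty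
  refine
    ⟨{ lattice := L
       discrete := inferInstance
       isZLattice := inferInstance
       motif := hfinite.toFinset
       motif_nonempty := ⟨_, hmotif q₀ hq₀⟩
       eq_of_sub_mem := ?_ }, rfl, ?_⟩
  · intro x hx y hy hxy
    rw [Set.Finite.mem_toFinset] at hx hy
    rw [← ZSpan.fract_eq_self.2 hx.1, ← ZSpan.fract_eq_self.2 hy.1, ZSpan.fract_eq_fract, hbL,
      neg_add_eq_sub, ← neg_sub]
    exact L.neg_mem hxy
  · ext z
    simp only [Literature.MathematicalPhysics.StatisticalMechanics.PeriodicConfiguration.points,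
      Set.mem_setOf_eq]
    constructor
    · rintro ⟨y, hy, g, hg, rfl⟩
      rw [Set.Finite.mem_toFinset] at hy
      exact hLD g hg y hy.2
    · intro hz
      exact ⟨ZSpan.fract b z, hmotif z hz, ZSpan.floor b z, hfloor z, by
        rw [ZSpan.fract_apply, sub_add_cancel]⟩

/-! ## The registered stub -/

/-- **LFP — FINITELY MANY ORBITS + FINITE POINT GROUP ⇒ `D` IS THE POINT SET OF A `PeriodicConfiguration 3`.**
For a Delone set `D ⊆ ℝ³` whose symmetry group has finitely many orbits on `D` and finitely many linear
parts, `D = Q.points` for a periodic configuration `Q` (lattice: the translation vectors of `D`,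
`lfp_exists_lattice`; motif: `D ∩` a fundamental domain, `lfp_periodic_of_lattice`).
[cite: DolbilinLagariasSenechal1998, Thm 1.1] -/
theorem stub_periodicOfFinitePointGroup : ∀ D : Delone.DeloneSet (EuclideanSpace ℝ (Fin 3)), Literature.Geometry.DiscreteGeometry.HasFinitelyManySymmetryOrbits (D : Set (EuclideanSpace ℝ (Fin 3))) → {A : EuclideanSpace ℝ (Fin 3) ≃ₗᵢ[ℝ] EuclideanSpace ℝ (Fin 3) | ∃ g : EuclideanSpace ℝ (Fin 3) ≃ᵃⁱ[ℝ] EuclideanSpace ℝ (Fin 3), g '' (D : Set (EuclideanSpace ℝ (Fin 3))) = (D : Set (EuclideanSpace ℝ (Fin 3))) ∧ g.linearIsometryEquiv = A}.Finite → ∃ Q : Literature.MathematicalPhysics.StatisticalMechanics.PeriodicConfiguration 3, Q.points = (D : Set (EuclideanSpace ℝ (Fin 3))) := by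
  intro D hfin hP
  obtain ⟨L, hLd, hLspan, hLD⟩ := lfp_exists_lattice D hfin hP
  haveI : DiscreteTopology L := hLd
  haveI : IsZLattice ℝ L := ⟨hLspan⟩
  obtain ⟨Q, -, hQ⟩ := lfp_periodic_of_lattice D L hLD
  exact ⟨Q, hQ⟩

end Summit.AtomisticToContinuum.Crystallization.Theorems.IsometryAtomsAtomicLawChargesCrystal

end
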